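import Summits.AnomalousDissipation.AnomalousDissipation.Theses.MomentParity
import Summits.AnomalousDissipation.AnomalousDissipation.Theorems.MomentParityGalerkinEnsembleRealization
import Summits.AnomalousDissipation.AnomalousDissipation.Theorems.ResolvedDissipation.Negative.KillShape
import Summits.AnomalousDissipation.AnomalousDissipation.Theorems.MomentParityResolvedDissipationInvariance

/-!
# Stub S3 `stub_supportPointDefect` of line `lh-energy-equality-bracket`, crux
  `MomentParity.ResolvedDissipation` (stmt-AnomalousDissipation-14284)

Folklore (stationarity + monotone convergence + Chebyshev/support). Let `Q` be a shift-invariant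
probability law on the trajectory space `𝒦 = pathSpace R L` whose mean window-`[0,1]` work
`W₀₁(ω) = ∫₀¹ Σ_k Re⟪c k, ω̄(t,k)⟫ dt` (`c = 𝓕f`, `Σ_k ‖c k‖ < ∞`) exceeds its mean resolved
dissipation `∫ dissMean ν K dQ` by a margin `η > 0` at every cutoff `K` (`0 ≤ ν`). Then some
point `ω` of the support of `Q` has, in `ℝ≥0∞`,
`ofReal(E(ω,2)/2) + ⨆_K ofReal(∫₁² pathDiss ν K ω) < ofReal(E(ω,1)/2 + W₁₂(ω))`,
`E(ω,t) = pathEnergyTot ω t`.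

Proof. (a) Transport to the window `[1,2]` by shift invariance (`pathExt_pathShift`):
`∫ D_K^{[1,2]} dQ = ∫ dissMean ν K dQ`, `∫ W₁₂ dQ = ∫ W₀₁ dQ`, `∫ E(·,2) dQ = ∫ E(·,1) dQ`.
(b) `∫⁻ F dQ = ofReal(e/2) + ⨆_K ofReal(d_K) ≤ ofReal(e/2 + w - η)` by monotone convergence
(`lintegral_iSup`; `pathDiss` is monotone in the cutoff), while
`∫⁻ G dQ ≥ ofReal(∫ (E₁/2 + W₁₂) dQ) = ofReal(e/2 + w)`; hence `∫⁻ F dQ < ∫⁻ G dQ`.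
(c) So `Q{F < G} > 0`, and a `Q`-positive set meets `supp Q`
(`Measure.nonempty_inter_support_of_pos`; `𝒦` is second countable).
-/

noncomputable section

set_option linter.dupNamespace false

namespace Summit.AnomalousDissipation.AnomalousDissipation.Theorems.MomentParityResolvedDissipation.LhBracket.SupportPointDefect

open MeasureTheory Filter Topology Set Function Metric UnitAddTorus
open scoped ENNReal InnerProductSpace RealInnerProductSpace BigOperators
open Literature.Analysis.FunctionSpaces Literature.Analysis.FunctionSpaces.Torus
open Literature.Analysis.FluidPDE Literature.Analysis.FluidPDE.Torus
open Summit.AnomalousDissipation.AnomalousDissipation.Theses.MomentParity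
open Summit.AnomalousDissipation.AnomalousDissipation.Theorems.MomentParity
open Summit.AnomalousDissipation.AnomalousDissipation.Theorems.QuarticGate.Negative
  (IsLevel IsBandTest polyGrad IsPolyStationary)
open Summit.AnomalousDissipation.AnomalousDissipation.Theorems

/-! ### Abstract measure theory: support points and the defect inequality -/

/-- `ofReal (∫ g) ≤ ∫⁻ ofReal g` for an integrable real function (the negative part only helps). -/
private theorem ofReal_integral_le_lintegral_ofReal {X : Type*} [MeasurableSpace X] {μ : Measure X}
    {g : X → ℝ} (hg : Integrable g μ) :
    ENNReal.ofReal (∫ x, g x ∂μ) ≤ ∫⁻ x, ENNReal.ofReal (g x) ∂μ := by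
  rw [integral_eq_lintegral_pos_part_sub_lintegral_neg_part hg]
  exact (ENNReal.ofReal_le_ofReal (sub_le_self _ ENNReal.toReal_nonneg)).trans
    ENNReal.ofReal_toReal_le

/-- **Chebyshev/support**: if `∫⁻ F dQ < ∫⁻ G dQ` then `F < G` at some point of the support of `Q`
(a `Q`-positive set meets the support in a hereditarily Lindelöf space). -/
private theorem exists_mem_support_of_lintegral_lt {X : Type*} [TopologicalSpace X]
    [MeasurableSpace X] [HereditarilyLindelofSpace X] {Q : Measure X} {F G : X → ℝ≥0∞}
    (h : ∫⁻ x, F x ∂Q < ∫⁻ x, G x ∂Q) : ∃ x ∈ Q.support, F x < G x := by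
  have hpos : 0 < Q {x | F x < G x} := by
    rw [pos_iff_ne_zero]
    intro h0
    have hae : ∀ᵐ x ∂Q, G x ≤ F x := by
      rw [ae_iff]
      simpa only [not_le] using h0
    exact absurd (lintegral_mono_ae hae) (not_le.2 h)
  obtain ⟨x, hx, hxs⟩ := Measure.nonempty_inter_support_of_pos hpos
  exact ⟨x, hxs, hx⟩

/-- **The defect inequality of the means.** On a finite measure space let `E₁, E₂ ≥ 0`, `W` be
integrable with `∫ E₂ = ∫ E₁`, and `D_K ≥ 0` integrable, measurable, monotone in `K`, with
`∫ D_K + η ≤ ∫ W` for every `K` (`η > 0`). Then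
`∫⁻ (ofReal (E₂/2) + ⨆_K ofReal D_K) < ∫⁻ ofReal (E₁/2 + W)`. -/
private theorem lintegral_defect_lt {X : Type*} [MeasurableSpace X] (Q : Measure X)
    [IsFiniteMeasure Q] (E1 E2 W : X → ℝ) (D : ℕ → X → ℝ) {η : ℝ} (hη : 0 < η)
    (hE : ∫ x, E2 x ∂Q = ∫ x, E1 x ∂Q) (hE1 : Integrable E1 Q) (hE2 : Integrable E2 Q)
    (hE2nn : ∀ x, 0 ≤ E2 x) (hE2m : Measurable E2)
    (hDm : ∀ K, Measurable (D K)) (hDi : ∀ K, Integrable (D K) Q) (hDnn : ∀ K x, 0 ≤ D K x)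
    (hDmono : ∀ x, Monotone fun K => D K x) (hW : Integrable W Q)
    (hmargin : ∀ K, (∫ x, D K x ∂Q) + η ≤ ∫ x, W x ∂Q) :
    ∫⁻ x, ENNReal.ofReal (E2 x / 2) + ⨆ K, ENNReal.ofReal (D K x) ∂Q <
      ∫⁻ x, ENNReal.ofReal (E1 x / 2 + W x) ∂Q := by
  -- the means
  set e := ∫ x, E1 x ∂Q with he
  set w := ∫ x, W x ∂Q with hw
  have he0 : 0 ≤ e := by rw [← hE]; exact integral_nonneg hE2nn
  have hd0 : 0 ≤ ∫ x, D 0 x ∂Q := integral_nonneg (hDnn 0)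
  have hw0 : η ≤ w := by linarith [hmargin 0]
  -- the energy term
  have h1 : ∫⁻ x, ENNReal.ofReal (E2 x / 2) ∂Q = ENNReal.ofReal (e / 2) := by
    refine (ofReal_integral_eq_lintegral_ofReal (hE2.div_const 2)
      (ae_of_all _ fun x => ?_)).symm.trans ?_
    · exact div_nonneg (hE2nn x) zero_le_two
    · show ENNReal.ofReal (∫ x, E2 x / 2 ∂Q) = ENNReal.ofReal (e / 2)
      rw [integral_div, hE]
  -- the dissipation terms
  have h2 : ∀ K, ∫⁻ x, ENNReal.ofReal (D K x) ∂Q ≤ ENNReal.ofReal (w - η) := by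
    intro K
    rw [← ofReal_integral_eq_lintegral_ofReal (hDi K) (ae_of_all _ (hDnn K))]
    exact ENNReal.ofReal_le_ofReal (by linarith [hmargin K])
  -- upper bound for the left side (monotone convergence)
  have hF : ∫⁻ x, ENNReal.ofReal (E2 x / 2) + ⨆ K, ENNReal.ofReal (D K x) ∂Q ≤
      ENNReal.ofReal (e / 2 + (w - η)) := by
    rw [lintegral_add_left (hE2m.div_const 2).ennreal_ofReal,
      lintegral_iSup (f := fun K x => ENNReal.ofReal (D K x)) (fun K => (hDm K).ennreal_ofReal)
        (fun K K' hKK' x => ENNReal.ofReal_le_ofReal (hDmono x hKK')),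
      h1, ENNReal.ofReal_add (by positivity) (by linarith)]
    exact add_le_add le_rfl (iSup_le h2)
  -- lower bound for the right side
  have hG : ENNReal.ofReal (e / 2 + w) ≤ ∫⁻ x, ENNReal.ofReal (E1 x / 2 + W x) ∂Q := by
    have h3 : ∫ x, (E1 x / 2 + W x) ∂Q = e / 2 + w := by
      rw [integral_add (hE1.div_const 2) hW, integral_div]
    rw [← h3]
    exact ofReal_integral_le_lintegral_ofReal ((hE1.div_const 2).add hW)
  refine hF.trans_lt (lt_of_lt_of_le ?_ hG)
  rw [ENNReal.ofReal_lt_ofReal_iff (by linarith)]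
  linarith

/-! ### The functionals on the trajectory space -/

/-- The resolved dissipation is monotone in the cutoff (`ν ≥ 0`). -/
private theorem pathDiss_mono {ν : ℝ} (hν : 0 ≤ ν) {K K' : ℕ} (h : K ≤ K') (ω : Path (Fin 3))
    (t : ℝ) : pathDiss ν K ω t ≤ pathDiss ν K' ω t := by
  unfold pathDiss
  refine mul_le_mul_of_nonneg_left (mul_le_mul_of_nonneg_left ?_ (by positivity)) hν
  exact Finset.sum_le_sum_of_subset_of_nonneg (freqBall_mono h) fun k _ _ =>
    mul_nonneg (freqNormSq_nonneg k) (sq_nonneg _)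

/-- The window integrals of the resolved dissipation are monotone in the cutoff on `𝒦`. -/
private theorem dissWindow_mono {ν : ℝ} (hν : 0 ≤ ν) {R : ℝ} {L : (Fin 3 → ℤ) → ℝ}
    (ω : ↥(pathSpace (d := Fin 3) R L)) {a b : ℝ} (hab : a ≤ b) :
    Monotone fun K : ℕ => ∫ t in a..b, pathDiss ν K ω.1 t :=
  fun K K' h => intervalIntegral.integral_mono_on hab (intervalIntegrable_pathDiss ω.2 ν K a b)
    (intervalIntegrable_pathDiss ω.2 ν K' a b) fun t _ => pathDiss_mono hν h ω.1 t

/-- The window integral of the resolved dissipation is continuous on `𝒦`. -/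
private theorem continuous_dissWindow (R : ℝ) (L : (Fin 3 → ℤ) → ℝ) (ν : ℝ) (K : ℕ) (a b : ℝ) :
    Continuous fun ω : ↥(pathSpace (d := Fin 3) R L) => ∫ t in a..b, pathDiss ν K ω.1 t :=
  intervalIntegral.continuous_parametric_intervalIntegral_of_continuous'
    (continuous_pathDiss R L ν K) a b

/-- The work integrand `(ω, t) ↦ Σ_k Re⟪c k, ω̄(t,k)⟫` is jointly continuous on `𝒦 × ℝ` when
`Σ_k ‖c k‖ < ∞` (Weierstrass `M`-test, `‖ω̄(t,k)‖ ≤ |R|`). -/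
private theorem continuous_workIntegrand (R : ℝ) (L : (Fin 3 → ℤ) → ℝ)
    {c : (Fin 3 → ℤ) → EuclideanSpace ℂ (Fin 3)} (hc : Summable fun k => ‖c k‖) :
    Continuous fun p : ↥(pathSpace (d := Fin 3) R L) × ℝ =>
      ∑' k : Fin 3 → ℤ, (inner ℂ (c k) (pathExt p.1.1 p.2 k)).re := by
  refine continuous_tsum (fun k => ?_) (hc.mul_right |R|) (fun k p => ?_)
  · exact Complex.continuous_re.comp (continuous_const.inner (continuous_pathExt_subtype_prod R L k))
  · rw [Real.norm_eq_abs]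
    refine (Complex.abs_re_le_norm _).trans ((norm_inner_le_norm _ _).trans ?_)
    exact mul_le_mul_of_nonneg_left (norm_pathExt_le p.1.2 p.2 k) (norm_nonneg _)

/-- The window work functional `ω ↦ ∫ₐᵇ Σ_k Re⟪c k, ω̄(t,k)⟫ dt` is continuous on `𝒦`. -/
private theorem continuous_workWindow (R : ℝ) (L : (Fin 3 → ℤ) → ℝ)
    {c : (Fin 3 → ℤ) → EuclideanSpace ℂ (Fin 3)} (hc : Summable fun k => ‖c k‖) (a b : ℝ) :
    Continuous fun ω : ↥(pathSpace (d := Fin 3) R L) =>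
      ∫ t in a..b, ∑' k : Fin 3 → ℤ, (inner ℂ (c k) (pathExt ω.1 t k)).re :=
  intervalIntegral.continuous_parametric_intervalIntegral_of_continuous'
    (continuous_workIntegrand R L hc) a b

/-! ### Transport by shift invariance -/

/-- Shift invariance transports `Q`-means: `∫ g ∘ θ dQ = ∫ g dQ`. -/
private theorem integral_comp_pathShiftOn {R : ℝ} {L : (Fin 3 → ℤ) → ℝ}
    {Q : Measure ↥(pathSpace (d := Fin 3) R L)}
    (hQθ : Q.map (pathShiftOn R L (pathShift_mapsTo R L)) = Q)
    {g : ↥(pathSpace (d := Fin 3) R L) → ℝ} (hg : AEStronglyMeasurable g Q) :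
    ∫ ω, g (pathShiftOn R L (pathShift_mapsTo R L) ω) ∂Q = ∫ ω, g ω ∂Q := by
  have h : AEStronglyMeasurable g (Q.map (pathShiftOn R L (pathShift_mapsTo R L))) := by rwa [hQθ]
  rw [← integral_map (continuous_pathShiftOn R L).measurable.aemeasurable h, hQθ]

/-- Stationarity of the energy: `∫ E(·,2) dQ = ∫ E(·,1) dQ`. -/
private theorem integral_pathEnergyTot_two {R : ℝ} {L : (Fin 3 → ℤ) → ℝ}
    {Q : Measure ↥(pathSpace (d := Fin 3) R L)}
    (hQθ : Q.map (pathShiftOn R L (pathShift_mapsTo R L)) = Q) :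
    ∫ ω, pathEnergyTot ω.1 2 ∂Q = ∫ ω, pathEnergyTot ω.1 1 ∂Q := by
  have hpt : ∀ ω : ↥(pathSpace (d := Fin 3) R L),
      pathEnergyTot (pathShiftOn R L (pathShift_mapsTo R L) ω).1 1 = pathEnergyTot ω.1 2 := by
    intro ω
    rw [coe_pathShiftOn_apply]
    unfold pathEnergyTot
    simp_rw [pathExt_pathShift ω.2 zero_le_one]
    norm_num
  have hg : AEStronglyMeasurable (fun ω : ↥(pathSpace (d := Fin 3) R L) => pathEnergyTot ω.1 1) Q :=
    ((measurable_pathEnergyTot R L).comp (measurable_id.prodMk measurable_const)).aestronglyMeasurable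
  calc ∫ ω, pathEnergyTot ω.1 2 ∂Q
      = ∫ ω, pathEnergyTot (pathShiftOn R L (pathShift_mapsTo R L) ω).1 1 ∂Q :=
        integral_congr_ae (ae_of_all _ fun ω => (hpt ω).symm)
    _ = ∫ ω, pathEnergyTot ω.1 1 ∂Q :=
        integral_comp_pathShiftOn hQθ (g := fun ω => pathEnergyTot ω.1 1) hg

/-- Stationarity of the resolved dissipation: `∫ (∫₁² pathDiss ν K) dQ = ∫ dissMean ν K dQ`. -/
private theorem integral_dissWindow {R : ℝ} {L : (Fin 3 → ℤ) → ℝ}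
    {Q : Measure ↥(pathSpace (d := Fin 3) R L)}
    (hQθ : Q.map (pathShiftOn R L (pathShift_mapsTo R L)) = Q) (ν : ℝ) (K : ℕ) :
    ∫ ω, (∫ t in (1 : ℝ)..2, pathDiss ν K ω.1 t) ∂Q = ∫ ω, dissMean ν K ω.1 ∂Q := by
  have hpt : ∀ ω : ↥(pathSpace (d := Fin 3) R L),
      dissMean ν K (pathShiftOn R L (pathShift_mapsTo R L) ω).1 =
        ∫ t in (1 : ℝ)..2, pathDiss ν K ω.1 t := by
    intro ω
    have h := dissMean_iterate_pathShift ω.2 ν K 1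
    rw [Function.iterate_one] at h
    rw [coe_pathShiftOn_apply, h]
    norm_num
  calc ∫ ω, (∫ t in (1 : ℝ)..2, pathDiss ν K ω.1 t) ∂Q
      = ∫ ω, dissMean ν K (pathShiftOn R L (pathShift_mapsTo R L) ω).1 ∂Q :=
        integral_congr_ae (ae_of_all _ fun ω => (hpt ω).symm)
    _ = ∫ ω, dissMean ν K ω.1 ∂Q :=
        integral_comp_pathShiftOn hQθ (g := fun ω => dissMean ν K ω.1)
          (continuous_dissMean R L ν K).aestronglyMeasurable

/-- Stationarity of the work: `∫ W₁₂ dQ = ∫ W₀₁ dQ`. -/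
private theorem integral_workWindow {R : ℝ} {L : (Fin 3 → ℤ) → ℝ}
    {Q : Measure ↥(pathSpace (d := Fin 3) R L)}
    (hQθ : Q.map (pathShiftOn R L (pathShift_mapsTo R L)) = Q)
    {c : (Fin 3 → ℤ) → EuclideanSpace ℂ (Fin 3)} (hc : Summable fun k => ‖c k‖) :
    ∫ ω, (∫ t in (1 : ℝ)..2, ∑' k : Fin 3 → ℤ, (inner ℂ (c k) (pathExt ω.1 t k)).re) ∂Q =
      ∫ ω, (∫ t in (0 : ℝ)..1, ∑' k : Fin 3 → ℤ, (inner ℂ (c k) (pathExt ω.1 t k)).re) ∂Q := by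
  have hpt : ∀ ω : ↥(pathSpace (d := Fin 3) R L),
      (∫ t in (0 : ℝ)..1, ∑' k : Fin 3 → ℤ,
        (inner ℂ (c k) (pathExt (pathShiftOn R L (pathShift_mapsTo R L) ω).1 t k)).re) =
        ∫ t in (1 : ℝ)..2, ∑' k : Fin 3 → ℤ, (inner ℂ (c k) (pathExt ω.1 t k)).re := by
    intro ω
    have heq : ∀ t ∈ uIcc (0 : ℝ) 1, (∑' k : Fin 3 → ℤ,
        (inner ℂ (c k) (pathExt (pathShiftOn R L (pathShift_mapsTo R L) ω).1 t k)).re) =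
        ∑' k : Fin 3 → ℤ, (inner ℂ (c k) (pathExt ω.1 (t + 1) k)).re := by
      intro t ht
      rw [uIcc_of_le zero_le_one] at ht
      rw [coe_pathShiftOn_apply]
      simp_rw [pathExt_pathShift ω.2 ht.1]
    rw [intervalIntegral.integral_congr heq, intervalIntegral.integral_comp_add_right
      (fun s => ∑' k : Fin 3 → ℤ, (inner ℂ (c k) (pathExt ω.1 s k)).re)]
    norm_num
  calc ∫ ω, (∫ t in (1 : ℝ)..2, ∑' k : Fin 3 → ℤ, (inner ℂ (c k) (pathExt ω.1 t k)).re) ∂Q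
      = ∫ ω, (∫ t in (0 : ℝ)..1, ∑' k : Fin 3 → ℤ,
          (inner ℂ (c k) (pathExt (pathShiftOn R L (pathShift_mapsTo R L) ω).1 t k)).re) ∂Q :=
        integral_congr_ae (ae_of_all _ fun ω => (hpt ω).symm)
    _ = ∫ ω, (∫ t in (0 : ℝ)..1, ∑' k : Fin 3 → ℤ, (inner ℂ (c k) (pathExt ω.1 t k)).re) ∂Q :=
        integral_comp_pathShiftOn hQθ
          (g := fun ω => ∫ t in (0 : ℝ)..1, ∑' k : Fin 3 → ℤ, (inner ℂ (c k) (pathExt ω.1 t k)).re)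
          (continuous_workWindow R L hc 0 1).aestronglyMeasurable

/-! ### The support point -/

/-- **The support point with a strict window-`[1,2]` inequality**, for a general absolutely
summable family of "force coefficients" `c`. -/
private theorem exists_mem_support_strict {R : ℝ} {L : (Fin 3 → ℤ) → ℝ} {ν η : ℝ} (hν : 0 ≤ ν)
    (hη : 0 < η) {c : (Fin 3 → ℤ) → EuclideanSpace ℂ (Fin 3)} (hc : Summable fun k => ‖c k‖)
    (Q : Measure ↥(pathSpace (d := Fin 3) R L)) [IsProbabilityMeasure Q]
    (hQθ : Q.map (pathShiftOn R L (pathShift_mapsTo R L)) = Q)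
    (hmargin : ∀ K : ℕ, (∫ ω, dissMean ν K ω.1 ∂Q) + η ≤
      ∫ ω, (∫ t in (0 : ℝ)..1, ∑' k : Fin 3 → ℤ, (inner ℂ (c k) (pathExt ω.1 t k)).re) ∂Q) :
    ∃ ω ∈ Q.support,
      ENNReal.ofReal (pathEnergyTot ω.1 2 / 2) +
          (⨆ K : ℕ, ENNReal.ofReal (∫ t in (1 : ℝ)..2, pathDiss ν K ω.1 t)) <
        ENNReal.ofReal (pathEnergyTot ω.1 1 / 2 +
          ∫ t in (1 : ℝ)..2, ∑' k : Fin 3 → ℤ, (inner ℂ (c k) (pathExt ω.1 t k)).re) := by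
  haveI : CompactSpace ↥(pathSpace (d := Fin 3) R L) := compactSpace_pathSpace R L
  -- energies: bounded and measurable
  have hEm : ∀ s : ℝ, Measurable fun ω : ↥(pathSpace (d := Fin 3) R L) => pathEnergyTot ω.1 s :=
    fun s => ((measurable_pathEnergyTot R L).comp
      (measurable_prodMk_right (α := ↥(pathSpace (d := Fin 3) R L)) (y := s)) :)
  have hEi : ∀ s : ℝ,
      Integrable (fun ω : ↥(pathSpace (d := Fin 3) R L) => pathEnergyTot ω.1 s) Q := by
    intro s
    refine Integrable.of_bound (hEm s).aestronglyMeasurable (R ^ 2) (ae_of_all _ fun ω => ?_)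
    rw [Real.norm_eq_abs, abs_of_nonneg (pathEnergyTot_nonneg ω.1 s)]
    exact pathEnergyTot_le ω.2 s
  -- the strict inequality of the `Q`-means, in `ℝ≥0∞`
  have key : (∫⁻ ω, ENNReal.ofReal (pathEnergyTot ω.1 2 / 2) +
        (⨆ K : ℕ, ENNReal.ofReal (∫ t in (1 : ℝ)..2, pathDiss ν K ω.1 t)) ∂Q) <
      ∫⁻ ω, ENNReal.ofReal (pathEnergyTot ω.1 1 / 2 +
        ∫ t in (1 : ℝ)..2, ∑' k : Fin 3 → ℤ, (inner ℂ (c k) (pathExt ω.1 t k)).re) ∂Q := by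
    refine lintegral_defect_lt Q (fun ω => pathEnergyTot ω.1 1) (fun ω => pathEnergyTot ω.1 2)
      (fun ω => ∫ t in (1 : ℝ)..2, ∑' k : Fin 3 → ℤ, (inner ℂ (c k) (pathExt ω.1 t k)).re)
      (fun K ω => ∫ t in (1 : ℝ)..2, pathDiss ν K ω.1 t) hη
      (integral_pathEnergyTot_two hQθ) (hEi 1) (hEi 2) (fun ω => pathEnergyTot_nonneg ω.1 2) (hEm 2)
      (fun K => (continuous_dissWindow R L ν K 1 2).measurable)
      (fun K => (continuous_dissWindow R L ν K 1 2).integrable_of_hasCompactSupport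
        (HasCompactSupport.of_compactSpace _))
      (fun K ω => intervalIntegral.integral_nonneg one_le_two fun t _ => pathDiss_nonneg hν K ω.1 t)
      (fun ω => dissWindow_mono hν ω one_le_two)
      ((continuous_workWindow R L hc 1 2).integrable_of_hasCompactSupport
        (HasCompactSupport.of_compactSpace _))
      (fun K => ?_)
    -- the margin, transported to the window `[1, 2]`
    beta_reduce
    rw [integral_dissWindow hQθ ν K, integral_workWindow hQθ hc]
    exact hmargin K
  exact exists_mem_support_of_lintegral_lt key

/-- **S3 · `stub_supportPointDefect`** — positive mean defect ⟹ a support point with a strict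
energy inequality on the window `[1, 2]` (see the module docstring): the case
`c = 𝓕f` of `exists_mem_support_strict`, `Σ_k ‖𝓕f k‖ < ∞` for smooth `f`
(`summable_norm_mFourierCoeff_of_isSmooth`). [folklore] -/
theorem stub_supportPointDefect :
    ∀ (f : UnitAddTorus (Fin 3) → EuclideanSpace ℝ (Fin 3)), Torus.IsSmooth f →
    ∀ (R : ℝ) (L : (Fin 3 → ℤ) → ℝ), (∀ k, 0 ≤ L k) → ∀ (ν η : ℝ), 0 ≤ ν → 0 < η →
    ∀ (Q : Measure ↥(pathSpace (d := Fin 3) R L)), IsProbabilityMeasure Q →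
      Q.map (pathShiftOn R L (pathShift_mapsTo R L)) = Q →
      (∀ K : ℕ, (∫ ω, dissMean ν K ω.1 ∂Q) + η ≤
          ∫ ω, (∫ t in (0 : ℝ)..1, ∑' k : Fin 3 → ℤ,
            (inner ℂ (mFourierCoeff (EuclideanSpace.complexify ∘ f) k) (pathExt ω.1 t k)).re) ∂Q) →
    ∃ ω ∈ Q.support,
      ENNReal.ofReal (pathEnergyTot ω.1 2 / 2) +
          (⨆ K : ℕ, ENNReal.ofReal (∫ t in (1 : ℝ)..2, pathDiss ν K ω.1 t)) <
        ENNReal.ofReal (pathEnergyTot ω.1 1 / 2 + ∫ t in (1 : ℝ)..2, ∑' k : Fin 3 → ℤ,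
            (inner ℂ (mFourierCoeff (EuclideanSpace.complexify ∘ f) k) (pathExt ω.1 t k)).re) := by
  intro f hf R L _hL ν η hν hη Q hQ hQθ hmargin
  exact exists_mem_support_strict hν hη (summable_norm_mFourierCoeff_of_isSmooth hf) Q hQθ hmargin

end Summit.AnomalousDissipation.AnomalousDissipation.Theorems.MomentParityResolvedDissipation.LhBracket.SupportPointDefect

end
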